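import Literature.NumberTheory.Automorphic.ResiduallyTrivialFixedCosetCount   -- ★ p846156 (this seat): ROW-0 `ncard_fixedBy_{unitary_rank_zero,rankStratum_zero}_eq_ncard_levelShift`
import Literature.NumberTheory.Automorphic.LatticeOrderStability              -- ★ F0P2-p01 (g13): `OrderStability.setOf_map_le_eq_setOf_map_units_eq` (coefficient-ring-free ORDER-STABILITY)
import HarnessLib

/-!
# ROW 0 = `#Fix(Y)`: the residually trivial `t`-fixed cosets are the cosets fixed by the Cayley unit `Y` of the shifted order `𝒪[(t − 1)∕ϖ] = 𝒪[Y]`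

Topic `NumberTheory/Automorphic`; namespace `Literature.NumberTheory.Automorphic`.  THEOREMS ONLY (no definition, no instance, no notation, no named fact,
no `sorry`); generic `[Field E] [ValuativeRel E]` with a uniformizing element `ϖ`, any `n`; then the CM one-place model.  Cell `pub/hodgecm-mathlib` (D-0151),
crux H413 = `stmt-HodgeConjecture-24833`; road «S3-tree» (architect A-p16 (g29)), brick T3′ (DESIGN v2 §2 (P-1), row `ψ₀` «ROW-0 per literal = T4′ ∘ ★ CAYLEY ∘ ★
counts»), organ **«ROW-0 = #FIX(Y)»** (A-p12 (g21), offer 17:40:14Z): ★ ROW-0 p846156 (`n₀ = #` shift-stable lattices) ∘ ★ ORDER-STABILITY (F0P2-p01: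
shift-stable ⟺ `Y`-fixed for a unit `Y` with `Y, Y⁻¹ ∈ 𝒪[X]`, `X ∈ 𝒪[Y]`, `X = 1 + ϖ⁻¹(t − 1)` — the Cayley element of ★ `SplitTorusOrderCayleyShift`) ∘ ★
`natCard_fixedBy_unitary_eq_ncard` backwards.  HONEST LABEL: HC_CM is proved only modulo the 2 remaining named inputs (hLiu418 24832, h413 24833) until rung 0
closes; nothing printed is asserted here.

THE MATHEMATICS.  For `γ, Y ∈ U = U(J) ≤ GL_n(E)` with `Y, Y⁻¹ ∈ 𝒪[X]` and `X ∈ 𝒪[Y]`, `X := 1 + ϖ⁻¹(γ − 1)`: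
`#{uK_U ∈ Fix_γ(U ⧸ K_U) : rank(red(u⁻¹γu) − 1) = 0} = #{Λ = Λ(u) : X·Λ ⊆ Λ} = #{Λ = Λ(u) : Y·Λ = Λ} = #Fix_Y(U ⧸ K_U)` — the level-`1` count of `γ` is the
level-`0` count of `Y` (whose root valuations are those of `γ` lowered by one, ★ CAYLEY `valuation_sub_cayley`), MEASURE-FREE (A-79).

* §1 **`ncard_fixedBy_unitary_rank_zero_eq_natCard_fixedBy_of_mem_adjoin`** (`U(J) ≤ GL_n(E)`).
* §2 **`ncard_fixedBy_rankStratum_zero_eq_natCard_fixedBy_of_mem_adjoin`** (CM place, one-place model `U(σ_w, H_w)(L_w)`).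

## References
* [Kottwitz1986] R. E. Kottwitz, *Base change for unit elements of Hecke algebras*, Compositio Math. 60 (1986): §3.
* [Rogawski1990] J. D. Rogawski, *Automorphic Representations of Unitary Groups in Three Variables* (1990): §4.9 Prop. 4.9.1 (b) p. 55.
* [Serre1980Trees] J.-P. Serre, *Trees* (1980): Ch. II §1.1–1.2.
-/

set_option autoImplicit false

noncomputable section

open scoped ValuativeRel Matrix MatrixGroups
open ValuativeRel Set NumberField IsDedekindDomain

namespace Literature.NumberTheory.Automorphic

open Literature.NumberTheory.Automorphic.IntegralReduction Literature.NumberTheory.Automorphic.UnitaryGroup Literature.NumberTheory.Automorphic.OrderStability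

/-! ## §1 Inside `U(J)`: the residually trivial `γ`-fixed cosets are the `Y`-fixed cosets -/

section Unitary

variable {E : Type*} [Field E] [ValuativeRel E] {n : ℕ} (σ : E →+* E) (J : GL (Fin n) E)

/-- **ROW 0 = `#Fix(Y)` INSIDE `U(J)`**: for `γ, Y ∈ U` with `Y, Y⁻¹ ∈ 𝒪[X]`, `X ∈ 𝒪[Y]`, `X = 1 + ϖ⁻¹(γ − 1)` (the Cayley unit of the shifted order):
`#{uK_U ∈ Fix_γ(U ⧸ K_U) : rank(red(u⁻¹γu) − 1) = 0} = #Fix_Y(U ⧸ K_U)` (★ ROW-0 ∘ ★ ORDER-STABILITY ∘ ★ `natCard_fixedBy_unitary_eq_ncard`).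
[cite: Kottwitz1986, §3] [cite: Serre1980Trees, Ch. II §1.1–1.2] [cite: Rogawski1990, §4.9 Prop. 4.9.1 (b) p. 55] -/
theorem ncard_fixedBy_unitary_rank_zero_eq_natCard_fixedBy_of_mem_adjoin {ϖ : E} (hϖ : IsUniformizingElement ϖ)
    (γ Y : ↥(unitaryGroupOfForm σ (J : Matrix (Fin n) (Fin n) E)))
    (hY : (((Y : GL (Fin n) E)) : Matrix (Fin n) (Fin n) E) ∈
      Algebra.adjoin 𝒪[E] ({1 + ϖ⁻¹ • ((((γ : GL (Fin n) E)) : Matrix (Fin n) (Fin n) E) - 1)} : Set (Matrix (Fin n) (Fin n) E)))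
    (hY' : ((((Y : GL (Fin n) E))⁻¹ : GL (Fin n) E) : Matrix (Fin n) (Fin n) E) ∈
      Algebra.adjoin 𝒪[E] ({1 + ϖ⁻¹ • ((((γ : GL (Fin n) E)) : Matrix (Fin n) (Fin n) E) - 1)} : Set (Matrix (Fin n) (Fin n) E)))
    (hX : (1 + ϖ⁻¹ • ((((γ : GL (Fin n) E)) : Matrix (Fin n) (Fin n) E) - 1)) ∈
      Algebra.adjoin 𝒪[E] ({(((Y : GL (Fin n) E)) : Matrix (Fin n) (Fin n) E)} : Set (Matrix (Fin n) (Fin n) E))) :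
    {q : ↥(unitaryGroupOfForm σ (J : Matrix (Fin n) (Fin n) E)) ⧸ (glInt n E).subgroupOf (unitaryGroupOfForm σ (J : Matrix (Fin n) (Fin n) E)) |
        q ∈ MulAction.fixedBy (↥(unitaryGroupOfForm σ (J : Matrix (Fin n) (Fin n) E)) ⧸ (glInt n E).subgroupOf (unitaryGroupOfForm σ (J : Matrix (Fin n) (Fin n) E))) γ ∧
          (redMat ((((q.out)⁻¹ * γ * q.out : ↥(unitaryGroupOfForm σ (J : Matrix (Fin n) (Fin n) E))) : GL (Fin n) E) : Matrix (Fin n) (Fin n) E) - 1).rank = 0}.ncard =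
      Nat.card (MulAction.fixedBy
        (↥(unitaryGroupOfForm σ (J : Matrix (Fin n) (Fin n) E)) ⧸ (glInt n E).subgroupOf (unitaryGroupOfForm σ (J : Matrix (Fin n) (Fin n) E))) Y) := by
  rw [ncard_fixedBy_unitary_rank_zero_eq_ncard_levelShift σ J hϖ γ,
    setOf_map_le_eq_setOf_map_units_eq
      (fun Λ : Submodule 𝒪[E] (Fin n → E) =>
        ∃ u ∈ unitaryGroupOfForm σ (J : Matrix (Fin n) (Fin n) E), Λ = Submodule.span 𝒪[E] (Set.range ((u : Matrix (Fin n) (Fin n) E))ᵀ))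
      (Y : GL (Fin n) E) hY hY' hX,
    natCard_fixedBy_unitary_eq_ncard σ J Y]

end Unitary

/-! ## §2 The CM place: `n₀(t) = #Fix(Y)` on the one-place model -/

section CM

variable (L : Type) [Field L] [NumberField L] [IsCMField L] (N : ℕ) (H : Matrix (Fin N) (Fin N) L) (v : HeightOneSpectrum (𝓞 ↥(maximalRealSubfield L)))
  (w : UnitaryGroup.PlacesOver L v) (hw : IsCMField.complexConj L • w.1 = w.1)

include hw in
/-- **ROW 0 AT A NON-SPLIT CM PLACE = `#Fix(Y)`**: for `t ∈ U(H)(L⁺_v)` and a unit `Y ∈ U(σ_w, H_w)(L_w)` of the shifted order (`Y, Y⁻¹ ∈ 𝒪_w[X]`, `X ∈ 𝒪_w[Y]`,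
`X = 1 + ϖ_w⁻¹(t_w − 1)`; per literal: ★ CAYLEY), the `r = 0` stratum count of ★ `classOrbitalIntegral_eq_mul_strata_three_of_deep` is
`n₀(t) = Nat.card Fix_Y(U(σ_w, H_w)(L_w) ⧸ (U ∩ GL_N(𝒪_w)))` — a unit fixed-point count at the shifted exponents. [cite: Kottwitz1986, §3] [cite: Rogawski1990, §4.9 Prop. 4.9.1 (b) p. 55] -/
theorem ncard_fixedBy_rankStratum_zero_eq_natCard_fixedBy_of_mem_adjoin (hJw : IsUnit (placeForm H w.1)) {ϖ : w.1.adicCompletion L}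
    (hϖ : IsUniformizingElement ϖ) (t : (cmDatum L N H).Local v)
    (Y : ↥(unitaryGroupOfForm (galAdicCompletionMap (L := L) (IsCMField.complexConj L) hw) (placeForm H w.1)))
    (hY : (((Y : GL (Fin N) (w.1.adicCompletion L))) : Matrix (Fin N) (Fin N) (w.1.adicCompletion L)) ∈
      Algebra.adjoin 𝒪[w.1.adicCompletion L] ({1 + ϖ⁻¹ • ((((localNonsplitEquiv (IsCMField.complexConj L) H (IsCMField.complexConj_ne_one L) w hw t :
        ↥(unitaryGroupOfForm (galAdicCompletionMap (L := L) (IsCMField.complexConj L) hw) (placeForm H w.1))) :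
          GL (Fin N) (w.1.adicCompletion L)) : Matrix (Fin N) (Fin N) (w.1.adicCompletion L)) - 1)} : Set (Matrix (Fin N) (Fin N) (w.1.adicCompletion L))))
    (hY' : ((((Y : GL (Fin N) (w.1.adicCompletion L)))⁻¹ : GL (Fin N) (w.1.adicCompletion L)) : Matrix (Fin N) (Fin N) (w.1.adicCompletion L)) ∈
      Algebra.adjoin 𝒪[w.1.adicCompletion L] ({1 + ϖ⁻¹ • ((((localNonsplitEquiv (IsCMField.complexConj L) H (IsCMField.complexConj_ne_one L) w hw t :
        ↥(unitaryGroupOfForm (galAdicCompletionMap (L := L) (IsCMField.complexConj L) hw) (placeForm H w.1))) :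
          GL (Fin N) (w.1.adicCompletion L)) : Matrix (Fin N) (Fin N) (w.1.adicCompletion L)) - 1)} : Set (Matrix (Fin N) (Fin N) (w.1.adicCompletion L))))
    (hX : (1 + ϖ⁻¹ • ((((localNonsplitEquiv (IsCMField.complexConj L) H (IsCMField.complexConj_ne_one L) w hw t :
        ↥(unitaryGroupOfForm (galAdicCompletionMap (L := L) (IsCMField.complexConj L) hw) (placeForm H w.1))) :
          GL (Fin N) (w.1.adicCompletion L)) : Matrix (Fin N) (Fin N) (w.1.adicCompletion L)) - 1)) ∈
      Algebra.adjoin 𝒪[w.1.adicCompletion L] ({(((Y : GL (Fin N) (w.1.adicCompletion L))) : Matrix (Fin N) (Fin N) (w.1.adicCompletion L))} :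
        Set (Matrix (Fin N) (Fin N) (w.1.adicCompletion L)))) :
    {q : (cmDatum L N H).Local v ⧸ cmLocalIntegralLevel L N H v |
        q ∈ MulAction.fixedBy ((cmDatum L N H).Local v ⧸ cmLocalIntegralLevel L N H v) t ∧
          (redMat ((((q.out⁻¹ * t * q.out : (cmDatum L N H).Local v)).val : GL (Fin N) (LocalRing L v)).val.map
            (Pi.evalRingHom (fun w' : UnitaryGroup.PlacesOver L v => w'.1.adicCompletion L) w)) - 1).rank = 0}.ncard =
      Nat.card (MulAction.fixedBy
        (↥(unitaryGroupOfForm (galAdicCompletionMap (L := L) (IsCMField.complexConj L) hw) (placeForm H w.1)) ⧸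
          (glInt N (w.1.adicCompletion L)).subgroupOf (unitaryGroupOfForm (galAdicCompletionMap (L := L) (IsCMField.complexConj L) hw) (placeForm H w.1))) Y) := by
  rw [ncard_fixedBy_rankStratum_eq_ncard_localNonsplitEquiv L N H v w hw t 0]
  exact ncard_fixedBy_unitary_rank_zero_eq_natCard_fixedBy_of_mem_adjoin (galAdicCompletionMap (L := L) (IsCMField.complexConj L) hw) hJw.unit hϖ
    (localNonsplitEquiv (IsCMField.complexConj L) H (IsCMField.complexConj_ne_one L) w hw t) Y hY hY' hX

end CM

end Literature.NumberTheory.Automorphic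

end
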